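import Summits.Ventures.CertifiedManyBodySolver.Certificates.SymRungV0core.Rok
import Summits.Ventures.CertifiedManyBodySolver.Certificates.SymRungV0core.WF
import Summits.Ventures.CertifiedManyBodySolver.Certificates.SymRungV0core.Fact0
import Summits.Ventures.CertifiedManyBodySolver.Certificates.SymRungV0core.Fact1a
import Summits.Ventures.CertifiedManyBodySolver.Certificates.SymRungV0core.Fact1b
import Summits.Ventures.CertifiedManyBodySolver.Certificates.SymRungV0core.Fact2a
import Summits.Ventures.CertifiedManyBodySolver.Certificates.SymRungV0core.Fact2b
import Summits.Ventures.CertifiedManyBodySolver.Certificates.SymRungV0core.Fact3a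
import Summits.Ventures.CertifiedManyBodySolver.Certificates.SymRungV0core.Fact3b
import Summits.Ventures.CertifiedManyBodySolver.Theorems.M3x2EdgeSplitSymReplaySound
import Summits.Ventures.CertifiedManyBodySolver.Statement

/-!
# Rung V = v0′ (CORE) — CLOSING: `−0.8942613 ≤ e₀(t=1, t'=0, U=8, n=7/8)` from the sharded, grouped R-replay with the box licence
`energyDensity_ge_of_shardsRGB cert hwf hRok c sizes2 lo hi hbox Ps2 hcount2 ⟨fact0x, fact1a, fact1b, fact2a, fact2b, fact3a, fact3b⟩ hfin`
(Theorems…BoxCanon, hub-lb-sym-eng-3 / hub-lb-sym-plan-1) on the RESHAPED partition `sizes2 = [1,25,2,27,2]` of `…Defs2` (seven shards; the base fact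
transported from the landed J = 3 statement `fact0`); data = String modules under `Certificates/SymRungV0core/Data/`; lander hub-lb-sym-eng-4 g1 (crit-1 V119).
Moves the tree's unconditional floor at (8,⅞,0) from −1.0238158 (`Certificates/SymRungW3Box2d3`) to −0.8942613047.  No bound of record moves by this module (#529 −0.8295699476 stays the certified row); the rung value −0.8942613 is 0.064 BELOW the −83/100 edge (stmt-Ventures-22024 NOT closed); computational grade (`native_decide`); no summit or crux statement is proved here; nothing here predicts superconductivity.
-/

namespace Summit.Ventures.CertifiedManyBodySolver.Certificates.SymRungV0core

open Summit.Ventures.CertifiedManyBodySolver.Theorems.SymReplay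

/-- **Shard fact 0 under the reshaped partition**, transported from the landed `fact0` (J = 3 statement). -/
theorem fact0x : shardOKRGB cert cpar sizes2 lo hi 0 Pbase = true := by
  have h := fact0
  rw [shardOKRGB] at h ⊢
  rwa [shardPolyAtRGFast_sizes2_zero]

/-- The seven partials sum to zero (box-canonical form). -/
theorem hfin : isZero (canonNFZB lo hi Ps2.flatten) = true := by native_decide

/-- The per-shard facts, assembled. -/
theorem hfacts : ShardFactsRGB cert cpar sizes2 lo hi 0 Ps2 := ⟨fact0x, fact1a, fact1b, fact2a, fact2b, fact3a, fact3b, trivial⟩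

/-- **Unconditional lower bound at `(t,t',U,n) = (1,0,8,7/8)`** from the replayed v0′ certificate. -/
theorem energyDensityTT'_ge_symValueR :
    ((symValueR cert : ℚ) : ℝ) ≤ Literature.MathematicalPhysics.QuantumLattice.ThermodynamicLimit.energyDensityTT' 1 0 8 (7 / 8) :=
  energyDensity_ge_of_shardsRGB cert hwf hRok cpar sizes2 lo hi hbox Ps2 hcount2 hfacts hfin

/-- The same bound for `energyDensity2D 1 8 (7/8)`. -/
theorem energyDensity2D_ge_symValueR :
    ((symValueR cert : ℚ) : ℝ) ≤ Literature.MathematicalPhysics.QuantumLattice.ThermodynamicLimit.energyDensity2D 1 8 (7 / 8) := by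
  have h := energyDensityTT'_ge_symValueR
  rwa [Literature.MathematicalPhysics.QuantumLattice.ThermodynamicLimit.energyDensityTT'_zero] at h

/-- **Exact form**: `−270273895186422731696475/2⁷⁸ ≤ e₀(t=1, U=8, n=7/8)`. -/
theorem energyDensity2D_ge_exact :
    ((-270273895186422731696475 : ℝ) / 302231454903657293676544) ≤
      Literature.MathematicalPhysics.QuantumLattice.ThermodynamicLimit.energyDensity2D 1 8 (7 / 8) := by
  have h := energyDensity2D_ge_symValueR
  rw [cert_value] at h
  exact_mod_cast h

/-- **Decimal form**: `−0.8943 ≤ e₀(t=1, U=8, n=7/8)` (improves `Certificates.SymRungW3Box2d3.…_ge_m1p0239`). -/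
theorem energyDensity2D_one_eight_sevenEighths_ge_m0p8943 :
    (-0.8943 : ℝ) ≤ Literature.MathematicalPhysics.QuantumLattice.ThermodynamicLimit.energyDensity2D 1 8 (7 / 8) := by
  have h := energyDensity2D_ge_symValueR
  rw [cert_value] at h
  refine le_trans ?_ h
  norm_num

/-- The row form (stmt-Ventures-22024 vocabulary): `M3EnergyLowerRow 0 (−2702…/2⁷⁸)` — 0.064 short of the crux's `−83/100`. -/
theorem m3_tp0_lowerRow_v0core :
    Summit.Ventures.CertifiedManyBodySolver.M3EnergyLowerRow 0 ((-270273895186422731696475 : ℚ) / 302231454903657293676544) := by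
  have h := energyDensityTT'_ge_symValueR
  rw [cert_value] at h
  exact h

end Summit.Ventures.CertifiedManyBodySolver.Certificates.SymRungV0core
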